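import Summits.QuantumFields.YangMills.Theorems.FlatTubeReductionSlowCoreInclusion
import HarnessLib

/-!
# The `u`-core inclusion with UNIFORM constants on the fibre core `‖v̂‖, ‖v̂′‖ ≤ r_T`: `kinDefect_w ≤ D ⇒ kinDefect_1 ≤ 2D + 8|E|τ_u²·Φ(D, r_T)²`, and contrapositively
# `{kinDefect_1 > 2D + 8|E|τ_u²Φ²} ⊆ {kinDefect_w > D}` on the pinned fibre core — the set inclusion that turns `…SlowReferenceTail` into the tail-at-`u` hypothesis of the core sandwich
# (route `FlatTubeReduction`, crux K1 `NearFlatRatioLaw` stmt-QuantumFields-24720; seat `ym-line-ftr-p1` g12; rate twin «ratepack-v3 / frozen fibres»; R2b1 RECORD rung — no summit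
# statement is proved here)

WHY (memo `Cruxes/NearFlatRatioLaw/Lines/ratepack-v3-frozen-g12.md` §5.11 (2)).  `…SlowCoreInclusion.kinDefect_one_le_of_kinDefect_slow_le` has fibre-dependent smallness hypotheses and a
fibre-dependent bootstrap amplitude; on the core `‖v̂‖, ‖v̂′‖ ≤ r_T` both are monotone in the fibre norms, so one pair of hypotheses at `r_T` serves the whole core and the amplitude is
bounded by its value `Φ(D, r_T)` at `r_T`.
  ★★ `kinDefect_one_le_uniform`, ★★ `kinDefect_slow_gt_of_one_gt` (contrapositive).
HONEST FRAMING: bookkeeping; femto rung R2b1 (RECORD label); not infinite volume, not a gap, not Clay.  No defs, no named facts, no `sorry`.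
-/

set_option autoImplicit false

noncomputable section

open MeasureTheory Filter Topology Real Set
open scoped BigOperators Quaternion
open Literature.MathematicalPhysics.QuantumFieldTheory
open Literature.MathematicalPhysics.QuantumLattice

namespace Summit.QuantumFields.YangMills.Theorems.FemtoTransferGap.RateTube

open Summit.QuantumFields.YangMills.Theorems.FemtoTransferGap
open Summit.QuantumFields.YangMills.Theorems.FemtoTransferGap.TwoLattice
open Summit.QuantumFields.YangMills.Theorems.FemtoTransferGap.TwoLattice.ConstTube
open Summit.QuantumFields.YangMills.Theorems.FemtoTransferGap.TwoLattice.Avg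

variable {L : ℕ} [NeZero L]

/-- ★★ **Uniform `u`-core inclusion.**  Capped fibres with `‖v̂‖, ‖v̂′‖ ≤ r_T`, slow datum `‖q(u_k) − 1‖ ≤ τ_u` (`τ_u ≥ 0`), colour-pinned `g` (`ε ≥ 0`), `kinDefect (oT u v) (oT u v′) g ≤ D`, and the
first-pass smallness AT `r_T`: `3L(√D + 4(√2r_T + τ_u) + 2√2r_T) < 1`, `9L(…) + ε ≤ 2`.  Then
`kinDefect (oT 1 v) (oT 1 v′) g ≤ 2D + 8|E|τ_u²·Φ²`, `Φ = (9L(√D + 2√2r_T) + ε)(1 + θ + θ²) + θ²·36L(√2r_T + τ_u)`, `θ = 18L(√2r_T + τ_u)`. [folklore] -/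
theorem kinDefect_one_le_uniform (u : GaugeConfig 3 1 SU2) {v v' : Edge 3 L → Fin 3 → ℝ} (hv1 : ∀ e, ∑ a, v e a ^ 2 ≤ 1) (hv'1 : ∀ e, ∑ a, v' e a ^ 2 ≤ 1)
    {τu rT ε D : ℝ} (hτu0 : 0 ≤ τu) (hε0 : 0 ≤ ε) (hvr : ‖linkEmbed L v‖ ≤ rT) (hv'r : ‖linkEmbed L v'‖ ≤ rT)
    (hu : ∀ k : Fin 3, ‖su2Quat (u (0, k)) - 1‖ ≤ τu) {g : Site 3 L → SU2} (hW : colourMean L g ∈ fpBall ε)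
    (hD : kinDefect L (orthoTube L u v) (orthoTube L u v') g ≤ D)
    (hsmall : 3 * L * (Real.sqrt D + 4 * (Real.sqrt 2 * rT + τu) + Real.sqrt 2 * (rT + rT)) < 1)
    (htwo : 9 * L * (Real.sqrt D + 4 * (Real.sqrt 2 * rT + τu) + Real.sqrt 2 * (rT + rT)) + ε ≤ 2) :
    kinDefect L (orthoTube L 1 v) (orthoTube L 1 v') g ≤ 2 * D + 8 * (Fintype.card (Edge 3 L) : ℝ) * τu ^ 2 *
      ((9 * L * (Real.sqrt D + Real.sqrt 2 * (rT + rT)) + ε) * (1 + 18 * L * (Real.sqrt 2 * rT + τu) + (18 * L * (Real.sqrt 2 * rT + τu)) ^ 2) +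
        (18 * L * (Real.sqrt 2 * rT + τu)) ^ 2 * (36 * L * (Real.sqrt 2 * rT + τu))) ^ 2 := by
  have hL0 : (0 : ℝ) ≤ L := Nat.cast_nonneg _
  have h2 : (0 : ℝ) ≤ Real.sqrt 2 := Real.sqrt_nonneg _
  have hn0 : 0 ≤ ‖linkEmbed L v‖ := norm_nonneg _
  have hn0' : 0 ≤ ‖linkEmbed L v'‖ := norm_nonneg _
  have hrT : 0 ≤ rT := hn0.trans hvr
  -- pointwise smallness from the uniform one
  have hmono1 : 3 * L * (Real.sqrt D + 4 * (Real.sqrt 2 * ‖linkEmbed L v‖ + τu) + Real.sqrt 2 * (‖linkEmbed L v‖ + ‖linkEmbed L v'‖)) ≤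
      3 * L * (Real.sqrt D + 4 * (Real.sqrt 2 * rT + τu) + Real.sqrt 2 * (rT + rT)) := by
    apply mul_le_mul_of_nonneg_left _ (by positivity)
    nlinarith [mul_le_mul_of_nonneg_left hvr h2, mul_le_mul_of_nonneg_left hv'r h2]
  have hmono2 : 9 * L * (Real.sqrt D + 4 * (Real.sqrt 2 * ‖linkEmbed L v‖ + τu) + Real.sqrt 2 * (‖linkEmbed L v‖ + ‖linkEmbed L v'‖)) ≤
      9 * L * (Real.sqrt D + 4 * (Real.sqrt 2 * rT + τu) + Real.sqrt 2 * (rT + rT)) := by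
    apply mul_le_mul_of_nonneg_left _ (by positivity)
    nlinarith [mul_le_mul_of_nonneg_left hvr h2, mul_le_mul_of_nonneg_left hv'r h2]
  have h := kinDefect_one_le_of_kinDefect_slow_le (L := L) u hv1 hv'1 hu hW hD (lt_of_le_of_lt hmono1 hsmall) (by linarith [hmono2])
  refine h.trans ?_
  have hD0 : 0 ≤ Real.sqrt D := Real.sqrt_nonneg _
  gcongr

/-- ★★ **Contrapositive (the set inclusion)**: under the same uniform hypotheses, `2D + 8|E|τ_u²Φ² < kinDefect (oT 1 v) (oT 1 v′) g ⇒ D < kinDefect (oT u v) (oT u v′) g`. [folklore] -/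
theorem kinDefect_slow_gt_of_one_gt (u : GaugeConfig 3 1 SU2) {v v' : Edge 3 L → Fin 3 → ℝ} (hv1 : ∀ e, ∑ a, v e a ^ 2 ≤ 1) (hv'1 : ∀ e, ∑ a, v' e a ^ 2 ≤ 1)
    {τu rT ε D : ℝ} (hτu0 : 0 ≤ τu) (hε0 : 0 ≤ ε) (hvr : ‖linkEmbed L v‖ ≤ rT) (hv'r : ‖linkEmbed L v'‖ ≤ rT)
    (hu : ∀ k : Fin 3, ‖su2Quat (u (0, k)) - 1‖ ≤ τu) {g : Site 3 L → SU2} (hW : colourMean L g ∈ fpBall ε)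
    (hsmall : 3 * L * (Real.sqrt D + 4 * (Real.sqrt 2 * rT + τu) + Real.sqrt 2 * (rT + rT)) < 1)
    (htwo : 9 * L * (Real.sqrt D + 4 * (Real.sqrt 2 * rT + τu) + Real.sqrt 2 * (rT + rT)) + ε ≤ 2)
    (hgt : 2 * D + 8 * (Fintype.card (Edge 3 L) : ℝ) * τu ^ 2 *
      ((9 * L * (Real.sqrt D + Real.sqrt 2 * (rT + rT)) + ε) * (1 + 18 * L * (Real.sqrt 2 * rT + τu) + (18 * L * (Real.sqrt 2 * rT + τu)) ^ 2) +
        (18 * L * (Real.sqrt 2 * rT + τu)) ^ 2 * (36 * L * (Real.sqrt 2 * rT + τu))) ^ 2 < kinDefect L (orthoTube L 1 v) (orthoTube L 1 v') g) :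
    D < kinDefect L (orthoTube L u v) (orthoTube L u v') g := by
  by_contra hle
  push Not at hle
  have h := kinDefect_one_le_uniform (L := L) u hv1 hv'1 hτu0 hε0 hvr hv'r hu hW hle hsmall htwo
  linarith

end Summit.QuantumFields.YangMills.Theorems.FemtoTransferGap.RateTube

end
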